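import Literature.AlgebraicGeometry.Resolution.ExtAnnihilatorLocalizationEq
import Literature.AlgebraicGeometry.Resolution.ExtAnnihilatorIndependence
import HarnessLib

/-!
# The `Ext`-annihilator ideal is transported by isomorphisms of the base ring

Topic: `Literature/AlgebraicGeometry/Resolution`. The last algebraic input for gluing the affine
`Ext`-annihilator ideals (`ExtAnnihilatorAffineGlobal.lean`) of the charts of a projective variety:
on an overlap the two ambient regular rings are ISOMORPHIC (not equal), with compatible surjections
onto the coordinate ring. An isomorphism `B ≅ B'` of base rings is a localization at the trivial
submonoid, so `ExtAnnihilatorLocalizationEq.lean` (the annihilators localize) and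
`ExtAnnihilatorIndependence.lean` (independence of the resolution) give:

* `isLocalization_bot_of_bijective` — a bijective algebra map `B → B'` presents `B'` as the
  localization of `B` at `⊥ = {1}`;
* `isLocalizedModule_bot_id` — for a `B'`-module `A` (a `B`-module by restriction), the identity
  `A → A` is a localization of modules at `⊥`;
* `FreeResolution.prod_annihilator_EMod_eq_map_of_bijective` — **for free resolutions of finite
  type `F` of `A` over `B` and `F'` of `A` over `B'`,
  `∏_{q ∈ T} Ann_{B'} E^q(F') = (∏_{q ∈ T} Ann_B E^q(F)) · B'`** for every index set `T` of
  positive integers.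

[cite: Matsumura1987, §19 Lemma 4, Appendix B p. 282; AtiyahMacdonald1969, Prop. 3.14]
-/

noncomputable section

open Module

universe u

namespace Literature.AlgebraicGeometry.Resolution

variable {B B' : Type u} [CommRing B] [CommRing B'] [Algebra B B']

/-- A bijective algebra map `B → B'` presents `B'` as the localization of `B` at the trivial
submonoid. [folklore] -/
theorem isLocalization_bot_of_bijective (hσ : Function.Bijective (algebraMap B B')) :
    IsLocalization (⊥ : Submonoid B) B' where
  map_units := fun ⟨s, hs⟩ => by
    rw [Submonoid.mem_bot] at hs
    subst hs
    simp
  surj := fun b' => by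
    obtain ⟨b, rfl⟩ := hσ.2 b'
    exact ⟨(b, 1), by simp⟩
  exists_of_eq := fun {x y} h => ⟨1, by simpa using hσ.1 h⟩

variable {A : Type u} [AddCommGroup A] [Module B' A] [Module B A] [IsScalarTower B B' A]

omit [Algebra B B'] [Module B' A] [IsScalarTower B B' A] in
/-- The identity is a localization of modules at the trivial submonoid. [folklore] -/
theorem isLocalizedModule_bot_id : IsLocalizedModule (⊥ : Submonoid B) (LinearMap.id : A →ₗ[B] A) where
  map_units := fun ⟨s, hs⟩ => by
    rw [Submonoid.mem_bot] at hs
    subst hs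
    simp
  surj := fun a => ⟨(a, 1), by simp⟩
  exists_of_eq := fun {x y} h => ⟨1, by simpa using h⟩

namespace FreeResolution

/-- **The `Ext`-annihilator ideal is transported by base isomorphisms**: for a bijective algebra
map `B → B'` of Noetherian rings, a `B'`-module `A`, and free resolutions of finite type `F` of `A`
over `B` and `F'` of `A` over `B'`, the products of annihilators of the `E^q` over any set `T` of
positive indices correspond: `∏ Ann_{B'} E^q(F') = (∏ Ann_B E^q(F)) B'`.
[cite: Matsumura1987, §19 Lemma 4, Appendix B p. 282] -/
theorem prod_annihilator_EMod_eq_map_of_bijective [IsNoetherianRing B] [IsNoetherianRing B']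
    (hσ : Function.Bijective (algebraMap B B')) (F : FreeResolution B A) (F' : FreeResolution B' A)
    (T : Finset ℕ) (hT : ∀ q ∈ T, 1 ≤ q) :
    (∏ q ∈ T, Module.annihilator B' (F'.EMod q)) =
      (∏ q ∈ T, Module.annihilator B (F.EMod q)).map (algebraMap B B') := by
  haveI := isLocalization_bot_of_bijective hσ
  haveI : IsLocalizedModule (⊥ : Submonoid B) (LinearMap.id : A →ₗ[B] A) :=
    isLocalizedModule_bot_id
  haveI : Module.Flat B B' := IsLocalization.flat B' (⊥ : Submonoid B)
  have hφ : IsBaseChange B' (LinearMap.id : A →ₗ[B] A) :=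
    (isLocalizedModule_iff_isBaseChange (⊥ : Submonoid B) B' _).1 inferInstance
  rw [← F.prod_annihilator_EMod_baseChange_eq (⊥ : Submonoid B) B' LinearMap.id hφ T hT]
  exact (F'.prod_annihilator_EMod_eq (F.baseChange B' LinearMap.id hφ) T)

end FreeResolution

end Literature.AlgebraicGeometry.Resolution

end
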